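import Summits.HodgeConjecture.CorCM.Census.CyclicCharacterEvenSylowLaw

/-!
# Cyclic characters, XXX: EVEN KERNEL, toward `d = 0` — two ADJACENT ties in different blocks, and the mixed three-across relation

COR-CM (cell `pub-hodgecm2`), count-neutral kernel combinatorics by the binder seat b09 (gen 43; lane CYCLIC-CHARACTER FIBRE LAW, part XXX), on parts XXIV, XXV
BY NAME.  Theorems only (no definition, no `decide`, no certificate, no named fact, no `sorry`).
HONEST FRAMING: `HC_CM` is NOT proved, here or anywhere in the tree; nothing here is a period or a headline.

For `d = 0` the even certificate of part XXVIII has ONE face too many (`φ₂ + 2 = β`); the numerics of the gen (`HOME/pub-hodgecm2-b09/lean-g43/py`) say that a cover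
plus ONE face producing `ζ` suffices, through ANY cover.  The even three-across face `gface X_{C∖b} b v` produces `ζ` exactly when its two tie corners `X_C` and
`X_{C∖b∪v}` are linearised in OPPOSITE directions (part XXV: down/up gives `ζ_b`; §3 here: up/down gives `ζ_v`).  To arrange this the two ties must lie in
DIFFERENT blocks, so that the cover orients one and an explicit face the other:

* §1 `apply_eq_zero_of_rt_tie` : if a base change `Q` carries one bottom tie of `T_0` to another, then `w Q = 0` (part XXIVʼs two nearest arc types, and the
  `w`-values `1 ≠ 2ᵏ⁻¹` of the deviations when `T_0·Q⁻¹ = T_1`).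
* §2 `exists_adjacent_tie_blk_ne` : for `|C| = m ≥ 2` some `b ∈ C`, `v ∈ F_0 ∖ C` has `X_{C∖b∪v}` outside the block of `X_C` — the `m²` adjacent ties are
  pairwise distinct while the block of `X_C` holds at most `2m − 1` bottom ties other than `X_C` (§1), and `m² > 2m − 1`.
* §3 `zeta_mem_of_threeAcross_even_up_down` : the even three-across face with `X_C` UP and `X_{C∖b∪v}` DOWN yields `ζ_v`.
Part XXXI assembles the `ζ`-certificate with `β − 2ᵏ⁻¹` faces.

## References
* [Pohlmann1968] H. Pohlmann, Algebraic cycles on abelian varieties of complex multiplication type, Ann. of Math. 88 (1968), Thm 1.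
-/

namespace Summit.HodgeConjecture.CorCM.Census.CyclicCharacter

open Finset
open Summit.HodgeConjecture.CorCM.Prior.AllgGroup.RfwfAllgGroup
open Summit.HodgeConjecture.CorCM.Census.BlockParity
open Summit.HodgeConjecture.CorCM.Census.Coinvariant
open Summit.HodgeConjecture.CorCM.Census.TwistGeneration
open Summit.HodgeConjecture.CorCM.Census.Nondegenerate
open Summit.HodgeConjecture.CorCM.Census.BaseBlock

noncomputable section

variable {G : Type*} [Group G] [Fintype G] [DecidableEq G] {k : ℕ} {w : G → ZMod (2 ^ k)} {c : G}

/-! ## §1 A base change between two bottom ties lies in the kernel -/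

/-- **A base change carrying a bottom tie of `T_0` to a bottom tie of `T_0` lies in `ker w`** (`k ≥ 2`, `w` onto): with `T_0 ∖ X, T_0 ∖ Y ⊆ F_0` of size
`m = |F_0|/2 ≥ 1` and `X·Q⁻¹ = Y`, the arc type `T_0·Q⁻¹` is at distance `m` from `Y`, hence `T_0` or `T_1` (part XXIV); `T_1` is impossible since the
`T_1`-deviation of `Y` has `w`-value `2ᵏ⁻¹` while `(T_0 ∖ X)·Q⁻¹` would have `w`-value `1`. [folklore] -/
theorem apply_eq_zero_of_rt_tie (hw : ∀ P Q : G, w (P * Q) = w P + w Q) (hk : 1 ≤ k) (hk2 : 2 ≤ k) (hc2 : c * c = 1) (hwc : w c ≠ 0)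
    (h1 : ∃ g₁ : G, w g₁ = 1) {X Y : CMF G c} (hX : (arcType hw hk hc2 hwc 0).1 \ X.1 ⊆ univ.filter fun s : G => w s = 0)
    (hY : (arcType hw hk hc2 hwc 0).1 \ Y.1 ⊆ univ.filter fun s : G => w s = 0)
    (h2X : 2 * ((arcType hw hk hc2 hwc 0).1 \ X.1).card = (univ.filter fun s : G => w s = 0).card)
    (h2Y : 2 * ((arcType hw hk hc2 hwc 0).1 \ Y.1).card = (univ.filter fun s : G => w s = 0).card)
    (hne : ((arcType hw hk hc2 hwc 0).1 \ X.1).Nonempty) {Q : G} (hQ : rt c Q X = Y) : w Q = 0 := by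
  haveI : NeZero (2 ^ k) := ⟨pow_ne_zero _ two_ne_zero⟩
  haveI : Fact (1 < 2 ^ k) := ⟨Nat.one_lt_two_pow (by omega)⟩
  have hd0 : ddist (rt c Q (arcType hw hk hc2 hwc 0)) Y = ((arcType hw hk hc2 hwc 0).1 \ X.1).card := by rw [← hQ, ddist_rt]; rfl
  have hd : ddist (rt c Q (arcType hw hk hc2 hwc 0)) Y = ((arcType hw hk hc2 hwc 0).1 \ Y.1).card := by omega
  have hneY : ((arcType hw hk hc2 hwc 0).1 \ Y.1).Nonempty := by
    rw [← card_pos] at hne ⊢; omega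
  rcases rt_arcType_eq_zero_or_one_of_tie hw hk hk2 hc2 hwc h1 hY h2Y hneY hd with h0 | h1'
  · -- `T_0·Q⁻¹ = T_0`: `w Q = 0` by injectivity of the arcs
    rw [rt_arcType, zero_sub] at h0
    have := arcType_injective hw hk hc2 hwc h1 h0
    exact neg_eq_zero.mp this
  · -- `T_0·Q⁻¹ = T_1`: compare `w`-values of the deviations
    exfalso
    have hwQ : -w Q = 1 := by
      rw [rt_arcType, zero_sub] at h1'
      exact arcType_injective hw hk hc2 hwc h1 h1'
    obtain ⟨d, hdX⟩ := hne
    have hd0 : w d = 0 := (mem_filter.mp (hX hdX)).2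
    have hdQ : d * Q⁻¹ ∈ (rt c Q (arcType hw hk hc2 hwc 0)).1 \ (rt c Q X).1 := by
      rw [mem_sdiff_rt_iff, inv_mul_cancel_right]; exact hdX
    rw [hQ, h1', sdiff_arcType_one_eq_image hw hk hc2 hwc Y hY, mem_image] at hdQ
    obtain ⟨s, hs, hsd⟩ := hdQ
    have hs0 : w s = 0 := (mem_filter.mp (mem_sdiff.mp hs).1).2
    have e := congrArg w hsd
    rw [hw, hs0, add_zero, hw, map_inv hw, hd0, zero_add, hwQ, apply_c hw hk hc2 hwc] at e
    -- `2ᵏ⁻¹ = 1` in `ℤ/2ᵏ` contradicts `k ≥ 2`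
    have := congrArg ZMod.val e
    rw [val_two_pow_pred hk, ZMod.val_one] at this
    have h4 : 2 ≤ 2 ^ (k - 1) := le_trans (pow_one 2).symm.le (Nat.pow_le_pow_right (by norm_num) (by omega))
    omega

/-! ## §2 Two adjacent ties in different blocks -/

/-- **An adjacent tie outside the block of `X_C`.**  For `C ⊆ F_0` with `2|C| = |F_0|` and `|C| ≥ 2` there are `b ∈ C` and `v ∈ F_0 ∖ C` such that NO type with
`T_0`-deviation `C ∖ b ∪ v` lies in the block of `X_C`: the `m²` such ties are distinct, and the block of `X_C` contains at most `|ker w| − 1 = 2m − 1` bottom ties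
other than `X_C` (§1). [folklore] -/
theorem exists_adjacent_tie_blk_ne (hw : ∀ P Q : G, w (P * Q) = w P + w Q) (hk : 1 ≤ k) (hk2 : 2 ≤ k) (hc2 : c * c = 1) (hwc : w c ≠ 0)
    (h1 : ∃ g₁ : G, w g₁ = 1) {C : Finset G} (hCF : C ⊆ univ.filter fun s : G => w s = 0)
    (hCm : 2 * C.card = (univ.filter fun s : G => w s = 0).card) (hC2 : 2 ≤ C.card) {X : CMF G c} (hX : (arcType hw hk hc2 hwc 0).1 \ X.1 = C) :
    ∃ b ∈ C, ∃ v ∈ (univ.filter fun s : G => w s = 0) \ C,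
      ∀ Y : CMF G c, (arcType hw hk hc2 hwc 0).1 \ Y.1 = insert v (C.erase b) → blk c Y ≠ blk c X := by
  classical
  by_contra hall
  push Not at hall
  -- for every pair choose the adjacent tie, inside the block of `X`
  have hch : ∀ p : G × G, ∃ Y : CMF G c, (p.1 ∈ C → p.2 ∈ (univ.filter fun s : G => w s = 0) \ C →
      (arcType hw hk hc2 hwc 0).1 \ Y.1 = insert p.2 (C.erase p.1) ∧ blk c Y = blk c X) := by
    rintro ⟨b, v⟩
    by_cases hb : b ∈ C
    · by_cases hv : v ∈ (univ.filter fun s : G => w s = 0) \ C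
      · obtain ⟨Y, hY, hblk⟩ := hall b hb v hv
        exact ⟨Y, fun _ _ => ⟨hY, hblk⟩⟩
      · exact ⟨X, fun _ h => absurd h hv⟩
    · exact ⟨X, fun h _ => absurd h hb⟩
  choose Yf hYf using hch
  set P := C ×ˢ ((univ.filter fun s : G => w s = 0) \ C) with hP
  -- the adjacent ties are pairwise distinct
  have hinj : Set.InjOn Yf ↑P := by
    rintro ⟨b, v⟩ hp ⟨b', v'⟩ hp' h
    rw [mem_coe, hP, mem_product] at hp hp'
    dsimp only at hp hp'
    have hd := (hYf (b, v) hp.1 hp.2).1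
    have hd' := (hYf (b', v') hp'.1 hp'.2).1
    dsimp only at hd hd'
    rw [h, hd'] at hd
    -- `insert v' (C ∖ b') = insert v (C ∖ b)`: `v = v'` (the element outside `C`), then `b = b'`
    have hvC : v ∉ C := (mem_sdiff.mp hp.2).2
    have hv'C : v' ∉ C := (mem_sdiff.mp hp'.2).2
    have hvv' : v = v' := by
      have : v ∈ insert v' (C.erase b') := by rw [hd]; exact mem_insert_self _ _
      rcases mem_insert.mp this with h | h
      · exact h
      · exact absurd (mem_of_mem_erase h) hvC
    subst hvv'
    have hbb' : b = b' := by
      by_contra hne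
      have : b' ∈ insert v (C.erase b) := mem_insert_of_mem (mem_erase.mpr ⟨fun e => hne e.symm, hp'.1⟩)
      rw [← hd] at this
      rcases mem_insert.mp this with h | h
      · exact hvC (h ▸ hp'.1)
      · exact (notMem_erase b' C) h
    rw [hbb']
  -- every adjacent tie in the block of `X` is `X·ν⁻¹` for a kernel element `ν ≠` (those fixing `C`): at most `|ker w| − 1` of them
  have h2X : 2 * ((arcType hw hk hc2 hwc 0).1 \ X.1).card = (univ.filter fun s : G => w s = 0).card := by rw [hX]; exact hCm
  have himg : P.image Yf ⊆ ((univ.filter fun s : G => w s = 0).image fun ν => rt c ν X).erase X := by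
    intro Y hY
    obtain ⟨⟨b, v⟩, hp, rfl⟩ := mem_image.mp hY
    rw [hP, mem_product] at hp
    dsimp only at hp
    obtain ⟨hd, hblk⟩ := hYf (b, v) hp.1 hp.2
    dsimp only at hd hblk
    have hvC : v ∉ C := (mem_sdiff.mp hp.2).2
    have hYsub : (arcType hw hk hc2 hwc 0).1 \ (Yf (b, v)).1 ⊆ univ.filter fun s : G => w s = 0 := by
      rw [hd]; exact insert_subset (mem_sdiff.mp hp.2).1 ((erase_subset b C).trans hCF)
    have h2Y : 2 * ((arcType hw hk hc2 hwc 0).1 \ (Yf (b, v)).1).card = (univ.filter fun s : G => w s = 0).card := by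
      rw [hd, card_insert_of_notMem (fun h => hvC (mem_of_mem_erase h)), card_erase_add_one hp.1]; exact hCm
    obtain ⟨Q, hQ⟩ := exists_rt_eq_of_blk_eq c hblk.symm
    have hQ0 : w Q = 0 := apply_eq_zero_of_rt_tie hw hk hk2 hc2 hwc h1 (hX.symm ▸ hCF) hYsub h2X h2Y (by rw [hX, ← card_pos]; omega) hQ
    rw [mem_erase]
    refine ⟨fun h => hvC ?_, mem_image.mpr ⟨Q, mem_filter.mpr ⟨mem_univ _, hQ0⟩, hQ⟩⟩
    have : v ∈ (arcType hw hk hc2 hwc 0).1 \ X.1 := by rw [← h, hd]; exact mem_insert_self _ _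
    rwa [hX] at this
  have hcardP : P.card = C.card * C.card := by
    rw [hP, card_product]; have := card_sdiff_add_card_eq_card hCF; congr 1; omega
  have hXmem : X ∈ (univ.filter fun s : G => w s = 0).image fun ν => rt c ν X :=
    mem_image.mpr ⟨1, mem_filter.mpr ⟨mem_univ _, map_one hw⟩, rt_one c X⟩
  have hle := card_le_card himg
  rw [card_image_of_injOn hinj, hcardP] at hle
  have hle2 := card_erase_add_one hXmem
  have hle3 : ((univ.filter fun s : G => w s = 0).image fun ν => rt c ν X).card ≤ (univ.filter fun s : G => w s = 0).card := card_image_le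
  -- `m² ≤ 2m − 1` is false for `m ≥ 2`
  nlinarith

/-! ## §3 The mixed three-across relation with `X_C` up -/

/-- **THE EVEN THREE-ACROSS FACE with the first tie UP and the second DOWN gives `ζ_t`.**  `T_0 ∖ X = B' ∖ b` (`b ∈ B' ⊆ F_0`, `2(|B'| − 1) < |F_0|`,
`2(|F_0| − |B'| − 1) < |F_0|`), `t ∈ F_0 ∖ B'`, the face `gface X b t` in `L`, the tie `X^{(b)}` linearised toward `T_1` (`eb`) and the tie `X^{(t)}` toward `T_0`
(`et`).  Then `ζ_t = ε_t + η_t ∈ L`. [folklore] -/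
theorem zeta_mem_of_threeAcross_even_up_down (hw : ∀ P Q : G, w (P * Q) = w P + w Q) (hk : 1 ≤ k) (hc2 : c * c = 1) (hwc : w c ≠ 0)
    (h1 : ∃ g₁ : G, w g₁ = 1) (L : Submodule ℤ (CMF G c →₀ ℤ))
    (htw : ∀ Φ : CMF G c, 2 ≤ bpot c (arcType hw hk hc2 hwc 0) Φ → ∃ Q t t' : G,
      bpot c (arcType hw hk hc2 hwc 0) Φ = ddist (rt c Q (arcType hw hk hc2 hwc 0)) Φ ∧
        t ∈ (rt c Q (arcType hw hk hc2 hwc 0)).1 \ Φ.1 ∧ t' ∈ (rt c Q (arcType hw hk hc2 hwc 0)).1 \ Φ.1 ∧ t ≠ t' ∧ gface c hc2 Φ t t' ∈ L)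
    {X : CMF G c} {B' : Finset G} {b : G} (hb : b ∈ B') (hX : (arcType hw hk hc2 hwc 0).1 \ X.1 = B'.erase b)
    (hB' : B' ⊆ univ.filter fun s => w s = 0)
    (hsmall : 2 * (B'.card - 1) < (univ.filter fun s : G => w s = 0).card)
    (hlarge : 2 * ((univ.filter fun s : G => w s = 0).card - B'.card - 1) < (univ.filter fun s : G => w s = 0).card)
    {t : G} (ht : w t = 0) (htB : t ∉ B') (hf : gface c hc2 X b t ∈ L)
    (eb : Finsupp.single (oflipCM c hc2 b X) (1 : ℤ) - ((∑ s ∈ (arcType hw hk hc2 hwc 1).1 \ (oflipCM c hc2 b X).1,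
      (Finsupp.single (oflipCM c hc2 s (arcType hw hk hc2 hwc 1)) (1 : ℤ) - Finsupp.single (arcType hw hk hc2 hwc 1) 1)) +
        Finsupp.single (arcType hw hk hc2 hwc 1) 1) ∈ L)
    (et : Finsupp.single (oflipCM c hc2 t X) (1 : ℤ) - ((∑ s ∈ (arcType hw hk hc2 hwc 0).1 \ (oflipCM c hc2 t X).1,
      (Finsupp.single (oflipCM c hc2 s (arcType hw hk hc2 hwc 0)) (1 : ℤ) - Finsupp.single (arcType hw hk hc2 hwc 0) 1)) +
        Finsupp.single (arcType hw hk hc2 hwc 0) 1) ∈ L) :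
    (Finsupp.single (oflipCM c hc2 t (arcType hw hk hc2 hwc 0)) (1 : ℤ) - Finsupp.single (arcType hw hk hc2 hwc 0) 1) +
      (Finsupp.single (oflipCM c hc2 t (arcType hw hk hc2 hwc 1)) (1 : ℤ) - Finsupp.single (arcType hw hk hc2 hwc 1) 1) ∈ L := by
  obtain ⟨Qm, hQm⟩ := exists_apply_eq hw h1 (-1)
  have eT₁ : arcType hw hk hc2 hwc 1 = rt c Qm (arcType hw hk hc2 hwc 0) := arcType_eq_rt hw hk hc2 hwc hQm
  have hb0 : w b = 0 := (mem_filter.mp (hB' hb)).2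
  have htF : t ∈ univ.filter (fun s : G => w s = 0) := mem_filter.mpr ⟨mem_univ _, ht⟩
  have hbt : b ≠ t := fun h => htB (h ▸ hb)
  -- deviation sets of the four corners
  have hXb : (arcType hw hk hc2 hwc 0).1 \ (oflipCM c hc2 b X).1 = B' := by
    rw [sdiff_oflipCM_eq_insert hw hk hc2 hwc hX hb0 (notMem_erase b B'), insert_erase hb]
  have hXt : (arcType hw hk hc2 hwc 0).1 \ (oflipCM c hc2 t X).1 = insert t (B'.erase b) :=
    sdiff_oflipCM_eq_insert hw hk hc2 hwc hX ht (fun h => htB (mem_of_mem_erase h))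
  have hXbt : (arcType hw hk hc2 hwc 0).1 \ (oflipCM c hc2 b (oflipCM c hc2 t X)).1 = insert t B' := by
    rw [sdiff_oflipCM_eq_insert hw hk hc2 hwc hXt hb0 (by rw [mem_insert]; push Not; exact ⟨hbt, notMem_erase b B'⟩),
      Finset.insert_comm, insert_erase hb]
  have hBt : insert t B' ⊆ univ.filter fun s : G => w s = 0 := insert_subset htF hB'
  have hce : (B'.erase b).card + 1 = B'.card := card_erase_add_one hb
  have hct : (insert t B').card = B'.card + 1 := card_insert_of_notMem htB
  -- distances: `X` near `T_0`, `X^{(b)(t)}` near `T_1`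
  have h₁ : 2 * ddist (rt c 1 (arcType hw hk hc2 hwc 0)) X < (univ.filter fun s : G => w s = 0).card := by
    rw [rt_one]; unfold ddist; rw [hX]; omega
  have h₂ : 2 * ddist (rt c Qm (arcType hw hk hc2 hwc 0)) (oflipCM c hc2 b (oflipCM c hc2 t X)) < (univ.filter fun s : G => w s = 0).card := by
    rw [← eT₁, ddist_arcType_one_eq hw hk hc2 hwc hXbt hBt, hct]; omega
  have e₁ := single_sub_normalForm_mem_of_toward hw hk hc2 hwc L htw 1 X h₁
  have e₂ := single_sub_normalForm_mem_of_toward hw hk hc2 hwc L htw Qm _ h₂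
  have e₃ : Finsupp.single (oflipCM c hc2 b X) (1 : ℤ) - ((∑ s ∈ (rt c Qm (arcType hw hk hc2 hwc 0)).1 \ (oflipCM c hc2 b X).1,
      (Finsupp.single (oflipCM c hc2 s (rt c Qm (arcType hw hk hc2 hwc 0))) (1 : ℤ) - Finsupp.single (rt c Qm (arcType hw hk hc2 hwc 0)) 1)) +
        Finsupp.single (rt c Qm (arcType hw hk hc2 hwc 0)) 1) ∈ L := by rw [← eT₁]; exact eb
  have e₄ : Finsupp.single (oflipCM c hc2 t X) (1 : ℤ) - ((∑ s ∈ (rt c 1 (arcType hw hk hc2 hwc 0)).1 \ (oflipCM c hc2 t X).1,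
      (Finsupp.single (oflipCM c hc2 s (rt c 1 (arcType hw hk hc2 hwc 0))) (1 : ℤ) - Finsupp.single (rt c 1 (arcType hw hk hc2 hwc 0)) 1)) +
        Finsupp.single (rt c 1 (arcType hw hk hc2 hwc 0)) 1) ∈ L := by rw [rt_one]; exact et
  have hrel := alt_normalForm_mem_of_mems hw hk hc2 hwc L hf 1 Qm Qm 1 e₁ e₂ e₃ e₄
  rw [rt_one, ← eT₁, hX, hXt, normalForm_one_eq hw hk hc2 hwc _ (hXbt.symm ▸ hBt), normalForm_one_eq hw hk hc2 hwc _ (hXb.symm ▸ hB'), hXbt, hXb,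
    sdiff_insert, sum_insert (fun h => htB (mem_of_mem_erase h))] at hrel
  set H : G → (CMF G c →₀ ℤ) := fun s =>
    Finsupp.single (oflipCM c hc2 s (arcType hw hk hc2 hwc 1)) (1 : ℤ) - Finsupp.single (arcType hw hk hc2 hwc 1) 1 with hH
  have hU : t ∈ (univ.filter fun s : G => w s = 0) \ B' := mem_sdiff.mpr ⟨htF, htB⟩
  have e1 : (∑ s ∈ (univ.filter fun s : G => w s = 0) \ B', H s) = H t + ∑ s ∈ ((univ.filter fun s : G => w s = 0) \ B').erase t, H s :=
    (add_sum_erase _ _ hU).symm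
  rw [e1] at hrel
  rw [← Submodule.neg_mem_iff]
  convert hrel using 1
  simp only [hH]
  abel

end

end Summit.HodgeConjecture.CorCM.Census.CyclicCharacter
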